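import Literature.Computability.QuantumComplexity.ForrelationMemLists
import Literature.Computability.Complexity.UnaryLeBinary
import Literature.Computability.Complexity.SplitOnesBricks
import Literature.Computability.Complexity.UnaryBricks
import HarnessLib

/-!
# Explicit `k`-fold Forrelation is in `PromiseBQP`, III: the circuit evaluator and the phase function

Third file of the instantiation (`ForrelationMemFields.lean`, `ForrelationMemLists.lean`): the
**white-box query** of Aaronson–Ambainis (SIAM J. Comput. 47 (2018), §6, p. 26: "simulate each
query by running the circuit `Cᵢ`") as a polynomial-time string function, in the brick algebra with
total semantics:

* `wireValF` — the value of a wire code: a gate reference `1 · bin m` reads bit `m` of the value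
  list `V`, an input `0 · bin i` reads the query register at the *rank* of `i` among the distinct
  read wires (`rankF`; model `wireBit`);
* `gateValF` — the value of a gate `⟨truth table, wires⟩`: the truth table (index `∑ vⱼ 2ʲ`,
  `Literature.Computability.MetaComplexity.truthTable`) is **halved** along the arguments taken from
  the last to the first (`revItemsF`, `halfFn`, `takeFn`/`dropFn`; model `tableSelect`), so that no
  index is ever written out (the function stays polynomial on every input, whatever the arities);
* `evalGatesF` — the list of gate values in program order (model `evalGatesM`, cf.
  `Circuit.wireVals`);
* `GphaseF` — **the phase function** on `⟨x, ⟨u, 1ʲ0^{L-j}⟩⟩`: parse `x = ⟨bin n, ⟨bin k, circuits⟩⟩`,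
  lay out the distinct read wires (`dedupF ∘ occAllF`), pick circuit `j` (`HashBricks.nthItemFn`),
  evaluate it on the register `u`, answer `[]` iff `1 ≤ j ≤ k` and the circuit outputs `1`;
  and the answers of the other modes: `GwF` (`1^{min(n, #R + 8)}`), `GkF` (`1^{min(k,|x|)+1}`),
  `GzF` (the zero test of the three registers).

## References

* S. Aaronson, A. Ambainis, *Forrelation*, SIAM J. Comput. 47 (2018), §6 (p. 26) [AaronsonAmbainis2018].
* S. Arora, B. Barak, *Computational Complexity: A Modern Approach*, CUP 2009, §1.3, §6.1 and
  Thm. 6.18 (proof: circuit evaluation in `P`) [AroraBarak2009].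
-/

noncomputable section

namespace Literature.Computability.QuantumComplexity

open _root_.Computability Polynomial Complexity Complexity.Brick Plumb

namespace ForrMem

open PhaseQuery

/-! ### The value of a wire -/

section Wire

/-- **The value of a wire code** (model): a gate reference reads the value list, an input reads the
query register at the rank of its numeral. [cite: AroraBarak2009, Thm. 6.18 (proof)] -/
def wireBit (Rl : List (List Bool)) (qc V wc : List Bool) : Bool :=
  if wc.head? = some true then V.getD (bitsToNat wc.tail) false else qc.getD (rankIdx wc.tail Rl) false

variable {Rc qc V wc : List Bool}

/-- On the record `⟨⟨R, ⟨qc, V⟩⟩, wc⟩`: the code of `R`. [folklore] -/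
def wRf : List Bool → List Bool := fstF ∘ fstF
/-- … the query register. [folklore] -/
def wqf : List Bool → List Bool := fstF ∘ sndF ∘ fstF
/-- … the value list. [folklore] -/
def wVf : List Bool → List Bool := sndF ∘ sndF ∘ fstF
/-- … the numeral of the wire code. [folklore] -/
def wnf : List Bool → List Bool := List.tail ∘ sndF

/-- The raw bit read by a wire code (`[]` or `[b]`). [folklore] -/
def wireRawF : List Bool → List Bool :=
  iteFn (isSetF (take1Fn ∘ sndF)) (bitAtFn ∘ fanoutFn (binToUnaryFn ∘ fanoutFn wVf wnf) wVf)
    (bitAtFn ∘ fanoutFn (sndF ∘ rankF ∘ fanoutFn wnf wRf) wqf)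

/-- **The wire-value brick**: one bit. [folklore] -/
def wireValF : List Bool → List Bool := isSetF wireRawF

/-- `wireRawF ∈ FP`. [folklore] -/
theorem wireRawF_mem_FP : wireRawF ∈ FP := by
  have hR : wRf ∈ FP := comp_mem_FP fstF_mem_FP fstF_mem_FP
  have hq : wqf ∈ FP := comp_mem_FP fstF_mem_FP (comp_mem_FP sndF_mem_FP fstF_mem_FP)
  have hV : wVf ∈ FP := comp_mem_FP sndF_mem_FP (comp_mem_FP sndF_mem_FP fstF_mem_FP)
  have hn : wnf ∈ FP := comp_mem_FP PRelSigma.tail_mem_FP sndF_mem_FP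
  exact iteFn_mem_FP (isSetF_mem_FP (comp_mem_FP take1Fn_mem_FP sndF_mem_FP))
    (comp_mem_FP bitAtFn_mem_FP (fanoutFn_mem_FP (comp_mem_FP binToUnaryFn_mem_FP (fanoutFn_mem_FP hV hn)) hV))
    (comp_mem_FP bitAtFn_mem_FP (fanoutFn_mem_FP (comp_mem_FP sndF_mem_FP (comp_mem_FP rankF_mem_FP (fanoutFn_mem_FP hn hR))) hq))

/-- `wireValF ∈ FP`. [folklore] -/
theorem wireValF_mem_FP : wireValF ∈ FP := isSetF_mem_FP wireRawF_mem_FP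

/-- `wireValF` is one-bit. [folklore] -/
theorem oneBit_wireValF : OneBit wireValF := oneBit_isSetF _

/-- A one-element window read as a bit. [folklore] -/
theorem isSetF_take_one (l : List Bool) (f : List Bool → List Bool) (w : List Bool) (h : f w = l.take 1) :
    isSetF f w = [l.headD false] := by
  rcases l with _ | ⟨b, l⟩
  · exact isSetF_of_nil (by rw [h]; rfl)
  · exact isSetF_of_eq (by rw [h]; rfl)

/-- Reading position `p` of a list as a window. [folklore] -/
theorem headD_drop (l : List Bool) (p : ℕ) : (l.drop p).headD false = l.getD p false := by
  rw [List.getD_eq_getElem?_getD, ← List.head?_drop, List.headD_eq_head?_getD]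

/-- **Value of `wireValF` on every record.** [cite: AroraBarak2009, Thm. 6.18 (proof)] -/
theorem wireValF_apply (Rc qc V wc : List Bool) :
    wireValF (boolPair (boolPair Rc (boolPair qc V)) wc) = [wireBit (decNil Rc) qc V wc] := by
  have eR : wRf (boolPair (boolPair Rc (boolPair qc V)) wc) = Rc := by simp [wRf]
  have eq : wqf (boolPair (boolPair Rc (boolPair qc V)) wc) = qc := by simp [wqf]
  have eV : wVf (boolPair (boolPair Rc (boolPair qc V)) wc) = V := by simp [wVf]
  have en : wnf (boolPair (boolPair Rc (boolPair qc V)) wc) = wc.tail := by simp [wnf]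
  rw [wireValF, wireBit]
  by_cases ht : wc.head? = some true
  · obtain ⟨wc', rfl⟩ : ∃ wc', wc = true :: wc' := by
      rcases wc with _ | ⟨b, wc'⟩ <;> simp at ht; exact ⟨wc', by rw [ht]⟩
    have hc : isSetF (take1Fn ∘ sndF) (boolPair (boolPair Rc (boolPair qc V)) (true :: wc')) = [true] :=
      isSetF_of_eq (by simp [take1Fn])
    rw [if_pos ht]
    refine isSetF_take_one (V.drop (bitsToNat wc')) _ _ ?_ |>.trans (by rw [headD_drop]; rfl)
    rw [wireRawF, iteFn_apply_true hc, Function.comp_apply, fanoutFn_apply, Function.comp_apply, fanoutFn_apply, eV, en,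
      binToUnaryFn_boolPair, bitAtFn_boolPair]
    simp only [ones, List.length_replicate, List.tail_cons]
    rcases Nat.lt_or_ge (bitsToNat wc') V.length with h | h
    · rw [min_eq_left h.le]
    · rw [min_eq_right h, List.drop_of_length_le h, List.drop_of_length_le le_rfl]
  · rw [if_neg ht]
    have hc : isSetF (take1Fn ∘ sndF) (boolPair (boolPair Rc (boolPair qc V)) wc) = [false] := by
      rcases wc with _ | ⟨b, wc'⟩
      · exact isSetF_of_nil (by simp [take1Fn])
      · cases b
        · exact isSetF_of_eq (by simp [take1Fn])
        · simp at ht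
    refine isSetF_take_one (qc.drop (rankIdx wc.tail (decNil Rc))) _ _ ?_ |>.trans (by rw [headD_drop])
    rw [wireRawF, iteFn_apply_false hc, Function.comp_apply, fanoutFn_apply, Function.comp_apply, Function.comp_apply,
      fanoutFn_apply, en, eR, rankF_apply, eq, bitAtFn_boolPair]
    simp [ones]

end Wire

/-! ### The value of a gate: halving the truth table -/

section Gate

/-- One halving step: keep the upper half of the table on a `1`, the lower half on a `0`. [folklore] -/
def halveStep (T : List Bool) (b : Bool) : List Bool := if b then T.drop (T.length / 2) else T.take (T.length / 2)

/-- **Table selection** (model): halve the table along the bits. [folklore] -/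
def tableSelect (T : List Bool) (bits : List Bool) : List Bool := bits.foldl halveStep T

/-- **The value of a gate code `⟨truth table, wires⟩`** (model): halve the table along the values of
the wires taken from the last to the first, read the remaining entry. [cite: AroraBarak2009, Thm. 6.18 (proof)] -/
def gateBitM (Rl : List (List Bool)) (qc V gc : List Bool) : Bool :=
  (tableSelect (fstF gc) (((decNil (sndF gc)).reverse).map (wireBit Rl qc V))).headD false

/-- On a step argument `⟨⟨⟨ctx, gc⟩, items⟩, ⟨wc, T⟩⟩`: the context `ctx = ⟨R, ⟨qc, V⟩⟩`. [folklore] -/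
def ctx3f : List Bool → List Bool := fstF ∘ fstF ∘ fstF

/-- The halving step. [folklore] -/
def stepT : List Bool → List Bool :=
  iteFn (wireValF ∘ fanoutFn ctx3f itemF) (dropFn ∘ fanoutFn (Brick.halfFn ∘ accF) accF) (takeFn ∘ fanoutFn (Brick.halfFn ∘ accF) accF)

/-- `stepT ∈ FP`. [folklore] -/
theorem stepT_mem_FP : stepT ∈ FP := by
  have hc : ctx3f ∈ FP := comp_mem_FP fstF_mem_FP (comp_mem_FP fstF_mem_FP fstF_mem_FP)
  have hh : (Brick.halfFn ∘ accF) ∈ FP := comp_mem_FP Brick.halfFn_mem_FP accF_mem_FP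
  exact iteFn_mem_FP (comp_mem_FP wireValF_mem_FP (fanoutFn_mem_FP hc itemF_mem_FP))
    (comp_mem_FP dropFn_mem_FP (fanoutFn_mem_FP hh accF_mem_FP)) (comp_mem_FP takeFn_mem_FP (fanoutFn_mem_FP hh accF_mem_FP))

/-- Value of `stepT`. [folklore] -/
theorem stepT_apply (Rc qc V gc L wc T : List Bool) :
    stepT (boolPair (boolPair (boolPair (boolPair Rc (boolPair qc V)) gc) L) (boolPair wc T)) =
      halveStep T (wireBit (decNil Rc) qc V wc) := by
  have hc : (wireValF ∘ fanoutFn ctx3f itemF) (boolPair (boolPair (boolPair (boolPair Rc (boolPair qc V)) gc) L) (boolPair wc T)) =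
      [wireBit (decNil Rc) qc V wc] := by
    rw [Function.comp_apply, fanoutFn_apply, itemF_apply]
    simp only [ctx3f, Function.comp_apply, fstF_boolPair]
    exact wireValF_apply Rc qc V wc
  rw [stepT, iteFn_apply hc, halveStep]
  split_ifs <;> simp [fanoutFn_apply, Brick.halfFn, ones]

/-- Growth of `stepT`: the table shrinks. [folklore] -/
theorem foldGrowth_stepT : FoldGrowth 0 stepT := by
  intro v
  rw [stepT, iteFn_of_oneBit (oneBit_wireValF.comp _)]
  split_ifs <;>
    simp only [Function.comp_apply, fanoutFn_apply, dropFn_boolPair, takeFn_boolPair, List.length_drop, List.length_take,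
      accF] <;> omega

/-- **The halved table** of the gate of the record `⟨⟨R, ⟨qc, V⟩⟩, gc⟩`. [folklore] -/
def gateTabF : List Bool → List Bool := foldFn stepT (fstF ∘ sndF ∘ fstF) ∘ fanoutFn (fun z => z) (revItemsF ∘ sndF ∘ sndF)

/-- `gateTabF ∈ FP`. [folklore] -/
theorem gateTabF_mem_FP : gateTabF ∈ FP := by
  have h1 : foldFn stepT (fstF ∘ sndF ∘ fstF) ∈ FP :=
    foldFn_mem_FP stepT_mem_FP (comp_mem_FP fstF_mem_FP (comp_mem_FP sndF_mem_FP fstF_mem_FP)) foldGrowth_stepT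
  exact comp_mem_FP h1 (fanoutFn_mem_FP (PolyTimeComputable.id _) (comp_mem_FP revItemsF_mem_FP (comp_mem_FP sndF_mem_FP sndF_mem_FP)))

/-- **Value of `gateTabF` on every record.** [folklore] -/
theorem gateTabF_apply (Rc qc V gc : List Bool) :
    gateTabF (boolPair (boolPair Rc (boolPair qc V)) gc) =
      tableSelect (fstF gc) (((decNil (sndF gc)).reverse).map (wireBit (decNil Rc) qc V)) := by
  rw [gateTabF, Function.comp_apply, foldFn_apply, fanoutFn_apply, sndF_boolPair, Function.comp_apply, Function.comp_apply,
    sndF_boolPair, revItemsF_apply, decNil_encList, tableSelect, List.foldl_map]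
  simp only [Function.comp_apply, fstF_boolPair, sndF_boolPair]
  exact congrArg₂ (List.foldl · · _) (funext fun T => funext fun wc => stepT_apply Rc qc V gc _ wc T) rfl

/-- **The gate-value brick**: one bit. [folklore] -/
def gateValF : List Bool → List Bool := isSetF (take1Fn ∘ gateTabF)

/-- `gateValF ∈ FP`. [folklore] -/
theorem gateValF_mem_FP : gateValF ∈ FP := isSetF_mem_FP (comp_mem_FP take1Fn_mem_FP gateTabF_mem_FP)

/-- **Value of `gateValF` on every record.** [cite: AroraBarak2009, Thm. 6.18 (proof)] -/
theorem gateValF_apply (Rc qc V gc : List Bool) :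
    gateValF (boolPair (boolPair Rc (boolPair qc V)) gc) = [gateBitM (decNil Rc) qc V gc] := by
  rw [gateValF, gateBitM]
  exact isSetF_take_one _ _ _ (by rw [Function.comp_apply, gateTabF_apply]; rfl)

/-- `gateValF` returns one bit on every input. [folklore] -/
theorem length_gateValF (z : List Bool) : (gateValF z).length = 1 := (oneBit_isSetF _).length_eq z

end Gate

/-! ### The values of all gates -/

section Gates

/-- **The list of gate values in program order** (model; cf. `Circuit.wireVals`). [cite: AroraBarak2009, Rem. 6.4] -/
def evalGatesM (Rl : List (List Bool)) (qc : List Bool) (gcs : List (List Bool)) : List Bool :=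
  gcs.foldl (fun V gc => V ++ [gateBitM Rl qc V gc]) []

/-- The step of the evaluation fold on `⟨⟨⟨R, qc⟩, gates⟩, ⟨gc, V⟩⟩`. [folklore] -/
def stepE (v : List Bool) : List Bool :=
  accF v ++ gateValF (fanoutFn (fanoutFn (fstF ∘ fstF ∘ fstF) (fanoutFn (sndF ∘ fstF ∘ fstF) accF)) itemF v)

/-- `stepE ∈ FP`. [folklore] -/
theorem stepE_mem_FP : stepE ∈ FP :=
  append_mem_FP accF_mem_FP (comp_mem_FP gateValF_mem_FP (fanoutFn_mem_FP
    (fanoutFn_mem_FP (comp_mem_FP fstF_mem_FP (comp_mem_FP fstF_mem_FP fstF_mem_FP))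
      (fanoutFn_mem_FP (comp_mem_FP sndF_mem_FP (comp_mem_FP fstF_mem_FP fstF_mem_FP)) accF_mem_FP)) itemF_mem_FP))

/-- Growth of `stepE`: one bit per gate. [folklore] -/
theorem foldGrowth_stepE : FoldGrowth 1 stepE :=
  foldGrowth_append (c := 1) (g := fun v => gateValF _) (fun v => rfl) fun v => by rw [length_gateValF]; omega

/-- **The evaluation brick** on `⟨⟨R, qc⟩, gates⟩`. [folklore] -/
def evalGatesF : List Bool → List Bool := foldFn stepE fun _ => []

/-- `evalGatesF ∈ FP`. [cite: AroraBarak2009, Thm. 6.18 (proof: "CKT-EVAL ∈ P")] -/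
theorem evalGatesF_mem_FP : evalGatesF ∈ FP := foldFn_mem_FP stepE_mem_FP (const_mem_FP []) foldGrowth_stepE

/-- **Value of `evalGatesF` on every input.** [cite: AroraBarak2009, Thm. 6.18 (proof)] -/
theorem evalGatesF_apply (Rc qc Gc : List Bool) :
    evalGatesF (boolPair (boolPair Rc qc) Gc) = evalGatesM (decNil Rc) qc (decNil Gc) := by
  rw [evalGatesF, foldFn_apply, sndF_boolPair, evalGatesM]
  exact congrArg₂ (List.foldl · · _) (funext fun V => funext fun gc => by
    rw [stepE, accF_apply, fanoutFn_apply, fanoutFn_apply, fanoutFn_apply, itemF_apply, accF_apply]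
    simp only [Function.comp_apply, fstF_boolPair, sndF_boolPair]
    rw [gateValF_apply]) rfl

end Gates

/-! ### The phase function and the other answers -/

section Phase

/-- On the record `⟨x, ⟨u, J⟩⟩`: the input `x`. [folklore] -/
def pxf : List Bool → List Bool := fstF
/-- … the query register `u`. [folklore] -/
def puf : List Bool → List Bool := fstF ∘ sndF
/-- … the layer register `J = 1ʲ 0^{L-j}`. [folklore] -/
def pJf : List Bool → List Bool := sndF ∘ sndF
/-- … `bin k` (`x = ⟨bin n, ⟨bin k, circuits⟩⟩`). [folklore] -/
def pkf : List Bool → List Bool := fstF ∘ sndF ∘ pxf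
/-- … the list of circuit codes. [folklore] -/
def pCLf : List Bool → List Bool := sndF ∘ sndF ∘ pxf
/-- … `1ʲ`. [folklore] -/
def pj1f : List Bool → List Bool := onesPrefixFn ∘ pJf
/-- … the code of the list `R` of distinct read wires. [folklore] -/
def pRf : List Bool → List Bool := dedupF ∘ occAllF ∘ pCLf
/-- … the code of circuit `j` (item `j - 1`). [folklore] -/
def pcjf : List Bool → List Bool := HashBricks.nthItemFn ∘ fanoutFn (List.tail ∘ pj1f) pCLf
/-- … the gate values of circuit `j` on `u`. [folklore] -/
def pVf : List Bool → List Bool := evalGatesF ∘ fanoutFn (fanoutFn pRf puf) (fstF ∘ pcjf)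
/-- … the output bit of circuit `j` on `u`. [folklore] -/
def poutf : List Bool → List Bool := wireValF ∘ fanoutFn (fanoutFn pRf (fanoutFn puf pVf)) (sndF ∘ pcjf)
/-- … the range test `1 ≤ j ≤ k`. [folklore] -/
def pinRangeF : List Bool → List Bool := andFn (isSetF (take1Fn ∘ pJf)) (isSetF (unLeBinFn ∘ fanoutFn pj1f pkf))

/-- **The phase function**: `[]` (phase `−1`) iff `1 ≤ j ≤ k` and circuit `j` outputs `1` on `u`.
[cite: AaronsonAmbainis2018, §6 (p. 26: simulate each query by running the circuit)] -/
def GphaseF : List Bool → List Bool := iteFn (andFn pinRangeF poutf) (fun _ => []) fun _ => [false]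

/-- The bricks of the phase function are polynomial time. [folklore] -/
theorem phase_parts_mem_FP : pRf ∈ FP ∧ pcjf ∈ FP ∧ pVf ∈ FP ∧ poutf ∈ FP ∧ pinRangeF ∈ FP := by
  have hx : pxf ∈ FP := fstF_mem_FP
  have hu : puf ∈ FP := comp_mem_FP fstF_mem_FP sndF_mem_FP
  have hJ : pJf ∈ FP := comp_mem_FP sndF_mem_FP sndF_mem_FP
  have hk : pkf ∈ FP := comp_mem_FP fstF_mem_FP (comp_mem_FP sndF_mem_FP hx)
  have hCL : pCLf ∈ FP := comp_mem_FP sndF_mem_FP (comp_mem_FP sndF_mem_FP hx)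
  have hj1 : pj1f ∈ FP := comp_mem_FP onesPrefixFn_mem_FP hJ
  have hR : pRf ∈ FP := comp_mem_FP dedupF_mem_FP (comp_mem_FP occAllF_mem_FP hCL)
  have hcj : pcjf ∈ FP := comp_mem_FP HashBricks.nthItemFn_mem_FP (fanoutFn_mem_FP (comp_mem_FP PRelSigma.tail_mem_FP hj1) hCL)
  have hV : pVf ∈ FP := comp_mem_FP evalGatesF_mem_FP (fanoutFn_mem_FP (fanoutFn_mem_FP hR hu) (comp_mem_FP fstF_mem_FP hcj))
  have hout : poutf ∈ FP :=
    comp_mem_FP wireValF_mem_FP (fanoutFn_mem_FP (fanoutFn_mem_FP hR (fanoutFn_mem_FP hu hV)) (comp_mem_FP sndF_mem_FP hcj))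
  have hin : pinRangeF ∈ FP :=
    andFn_mem_FP (isSetF_mem_FP (comp_mem_FP take1Fn_mem_FP hJ)) (isSetF_mem_FP (comp_mem_FP unLeBinFn_mem_FP (fanoutFn_mem_FP hj1 hk)))
  exact ⟨hR, hcj, hV, hout, hin⟩

/-- `GphaseF ∈ FP`. [cite: AroraBarak2009, §1.3] -/
theorem GphaseF_mem_FP : GphaseF ∈ FP := by
  obtain ⟨-, -, -, hout, hin⟩ := phase_parts_mem_FP
  exact iteFn_mem_FP (andFn_mem_FP hin hout) (const_mem_FP _) (const_mem_FP _)

/-- **The model of the phase bit** on `⟨x, ⟨u, J⟩⟩` with `j` the leading block of `J`. [folklore] -/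
def phaseBitM (x u : List Bool) (j : ℕ) : Bool :=
  let CL := sndF (sndF x)
  let Rl := dedupVals (occAll CL)
  let cj := fstF (sndF^[j - 1] CL)
  let V := evalGatesM Rl u (decNil (fstF cj))
  (decide (1 ≤ j) && decide (bitsToNat (unLeBinFn (boolPair (ones j) (fstF (sndF x)))) = 1)) && wireBit Rl u V (sndF cj)

/-- The splitting of a block word. [folklore] -/
theorem splitOnes_junary (L j : ℕ) (hj : j ≤ L) : (splitOnes (junary L j)).1 = j := by
  unfold junary
  rcases Nat.lt_or_ge j L with h | h
  · obtain ⟨d, hd⟩ : ∃ d, L - j = d + 1 := ⟨L - j - 1, by omega⟩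
    rw [hd, List.replicate_succ, show List.replicate j true = ones j from rfl, splitOnes_ones_append]
  · have : L - j = 0 := by omega
    rw [this, List.replicate_zero, List.append_nil, show List.replicate j true = ones j from rfl, splitOnes_ones]

/-- The first bit of a block word. [folklore] -/
theorem take_one_junary (L j : ℕ) (hj : j ≤ L) (hL : 1 ≤ L) : (junary L j).take 1 = [decide (1 ≤ j)] := by
  unfold junary
  rcases j with _ | j
  · obtain ⟨d, hd⟩ : ∃ d, L = d + 1 := ⟨L - 1, by omega⟩
    simp [hd, List.replicate_succ]
  · simp [List.replicate_succ]

/-- **Value of the phase function** on `⟨x, ⟨u, 1ʲ 0^{L-j}⟩⟩` (`j ≤ L`, `1 ≤ L`). [cite: AaronsonAmbainis2018, §6 (p. 26)] -/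
theorem GphaseF_apply (x u : List Bool) {L j : ℕ} (hj : j ≤ L) (hL : 1 ≤ L) :
    GphaseF (boolPair x (boolPair u (junary L j))) = if phaseBitM x u j then [] else [false] := by
  set r := boolPair x (boolPair u (junary L j)) with hr
  have ex : pxf r = x := by simp [pxf, hr]
  have eu : puf r = u := by simp [puf, hr]
  have eJ : pJf r = junary L j := by simp [pJf, hr]
  have ej1 : pj1f r = ones j := by rw [pj1f, Function.comp_apply, eJ, onesPrefixFn, splitOnes_junary L j hj]
  have eCL : pCLf r = sndF (sndF x) := by simp [pCLf, Function.comp_apply, ex]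
  have ek : pkf r = fstF (sndF x) := by simp [pkf, Function.comp_apply, ex]
  have eR : pRf r = encList (dedupVals (occAll (sndF (sndF x)))) := by
    rw [pRf, Function.comp_apply, Function.comp_apply, eCL, occAllF_apply, dedupF_apply, decNil_encList]
  have ecj : pcjf r = fstF (sndF^[j - 1] (sndF (sndF x))) := by
    rw [pcjf, Function.comp_apply, fanoutFn_apply, Function.comp_apply, ej1, eCL, HashBricks.nthItemFn_boolPair]
    simp [ones]
  have eV : pVf r = evalGatesM (dedupVals (occAll (sndF (sndF x)))) u (decNil (fstF (fstF (sndF^[j - 1] (sndF (sndF x)))))) := by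
    rw [pVf, Function.comp_apply, fanoutFn_apply, fanoutFn_apply, eR, eu, Function.comp_apply, ecj, evalGatesF_apply, decNil_encList]
  have eout : poutf r = [wireBit (dedupVals (occAll (sndF (sndF x)))) u (pVf r) (sndF (fstF (sndF^[j - 1] (sndF (sndF x)))))] := by
    rw [poutf, Function.comp_apply, fanoutFn_apply, fanoutFn_apply, fanoutFn_apply, eR, eu, Function.comp_apply, ecj, wireValF_apply,
      decNil_encList]
  have ein : pinRangeF r = [decide (1 ≤ j) && decide (bitsToNat (unLeBinFn (boolPair (ones j) (fstF (sndF x)))) = 1)] := by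
    rw [pinRangeF]
    refine andFn_apply (isSetF_of_eq (by rw [Function.comp_apply, eJ, take1Fn, take_one_junary L j hj hL])) ?_
    rw [isSetF, Function.comp_apply, fanoutFn_apply, Function.comp_apply, fanoutFn_apply, ej1, ek, eqValFn_boolPair]
    simp
  rw [GphaseF, iteFn_apply (andFn_apply ein eout), eV]
  congr 1

/-- The ruler of mode `W`: `1^{#R + 8}`. [folklore] -/
def rulerF : List Bool → List Bool := fun x => (lenItemsF ∘ dedupF ∘ occAllF ∘ sndF ∘ sndF) x ++ ones 8

/-- `rulerF ∈ FP`. [folklore] -/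
theorem rulerF_mem_FP : rulerF ∈ FP :=
  append_mem_FP (comp_mem_FP lenItemsF_mem_FP (comp_mem_FP dedupF_mem_FP (comp_mem_FP occAllF_mem_FP
    (comp_mem_FP sndF_mem_FP sndF_mem_FP)))) (const_mem_FP _)

/-- **The answer of mode `W`**: `1^{min(n, #R + 8)}`. [cite: AaronsonAmbainis2018, §6 (p. 26)] -/
def GwF : List Bool → List Bool := binToUnaryFn ∘ fanoutFn rulerF fstF

/-- `GwF ∈ FP`. [folklore] -/
theorem GwF_mem_FP : GwF ∈ FP := comp_mem_FP binToUnaryFn_mem_FP (fanoutFn_mem_FP rulerF_mem_FP fstF_mem_FP)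

/-- **Value of `GwF` on every input.** [folklore] -/
theorem GwF_apply (x : List Bool) :
    GwF x = ones (min (bitsToNat (fstF x)) ((dedupVals (occAll (sndF (sndF x)))).length + 8)) := by
  rw [GwF, Function.comp_apply, fanoutFn_apply, binToUnaryFn_boolPair, rulerF]
  simp only [Function.comp_apply, occAllF_apply, dedupF_apply, decNil_encList, lenItemsF_apply]
  simp [ones]

/-- **The answer of mode `K`**: `1^{min(k, |x|) + 1}`. [cite: AaronsonAmbainis2018, §6 (p. 26)] -/
def GkF : List Bool → List Bool := fun x => (binToUnaryFn ∘ fanoutFn onesFn (fstF ∘ sndF)) x ++ [true]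

/-- `GkF ∈ FP`. [folklore] -/
theorem GkF_mem_FP : GkF ∈ FP :=
  append_mem_FP (comp_mem_FP binToUnaryFn_mem_FP (fanoutFn_mem_FP onesFn_mem_FP (comp_mem_FP fstF_mem_FP sndF_mem_FP))) (const_mem_FP _)

/-- **Value of `GkF` on every input.** [folklore] -/
theorem GkF_apply (x : List Bool) : GkF x = ones (min (bitsToNat (fstF (sndF x))) x.length) ++ [true] := by
  simp [GkF, fanoutFn_apply, onesFn, RevDesc.unaryEncodeNat_eq_replicate, ones]

/-- The zero test of one register: `[1]` iff its binary value is `0`. [folklore] -/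
def ztF (sel : List Bool → List Bool) : List Bool → List Bool :=
  iteFn (eqValFn ∘ fanoutFn sel fun _ => []) (fun _ => [true]) fun _ => []

/-- `ztF sel ∈ FP`. [folklore] -/
theorem ztF_mem_FP {sel : List Bool → List Bool} (h : sel ∈ FP) : ztF sel ∈ FP :=
  iteFn_mem_FP (comp_mem_FP eqValFn_mem_FP (fanoutFn_mem_FP h (const_mem_FP _))) (const_mem_FP _) (const_mem_FP _)

/-- Value of `ztF`. [folklore] -/
theorem ztF_apply (sel : List Bool → List Bool) (z : List Bool) : ztF sel z = if bitsToNat (sel z) = 0 then [true] else [] := by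
  rw [ztF, iteFn_apply (b := decide (bitsToNat (sel z) = 0)) (by simp [fanoutFn_apply])]
  by_cases h : bitsToNat (sel z) = 0 <;> simp [h]

/-- **The answer of mode `Z`** on `⟨q₀, ⟨q₁, q₂⟩⟩`: one `1` for every register of value `0`.
[cite: AaronsonAmbainis2018, §6 (p. 26: test for the all-zero state)] -/
def GzF : List Bool → List Bool := fun z => ztF fstF z ++ (ztF (fstF ∘ sndF) z ++ ztF (sndF ∘ sndF) z)

/-- `GzF ∈ FP`. [folklore] -/
theorem GzF_mem_FP : GzF ∈ FP :=
  append_mem_FP (ztF_mem_FP fstF_mem_FP) (append_mem_FP (ztF_mem_FP (comp_mem_FP fstF_mem_FP sndF_mem_FP))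
    (ztF_mem_FP (comp_mem_FP sndF_mem_FP sndF_mem_FP)))

/-- A bit string has binary value `0` iff it is all zeros. [folklore] -/
theorem bitsToNat_eq_zero_iff (q : List Bool) : bitsToNat q = 0 ↔ q = zeros q.length := by
  induction q with
  | nil => simp
  | cons b q ih =>
    rw [bitsToNat_cons, List.length_cons]
    cases b <;> simp [ih, List.replicate_succ] 

/-- **Value of `GzF`**: empty iff no register is zero. [cite: AaronsonAmbainis2018, §6 (p. 26)] -/
theorem GzF_eq_nil_iff (q0 q1 q2 : List Bool) :
    GzF (boolPair q0 (boolPair q1 q2)) = [] ↔ (q0 ≠ zeros q0.length ∧ q1 ≠ zeros q1.length ∧ q2 ≠ zeros q2.length) := by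
  simp only [GzF, ztF_apply, Function.comp_apply, fstF_boolPair, sndF_boolPair, List.append_eq_nil_iff, bitsToNat_eq_zero_iff]
  refine ⟨fun ⟨h0, h1, h2⟩ => ⟨?_, ?_, ?_⟩, fun ⟨h0, h1, h2⟩ => ⟨?_, ?_, ?_⟩⟩
  · intro h; rw [if_pos h] at h0; exact List.cons_ne_nil _ _ h0
  · intro h; rw [if_pos h] at h1; exact List.cons_ne_nil _ _ h1
  · intro h; rw [if_pos h] at h2; exact List.cons_ne_nil _ _ h2
  · rw [if_neg h0]
  · rw [if_neg h1]
  · rw [if_neg h2]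

end Phase

end ForrMem

end Literature.Computability.QuantumComplexity
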